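import Mathlib.Data.Real.Basic
import Mathlib.Tactic.Linarith
import Mathlib.Tactic.Ring
import Mathlib.Tactic.Positivity
import HarnessLib

/-!
# Bridge concavity of the increasing star — the algebraic core (Theorem B of prim-sahi-p2 gen 18)

Support file for the Sahi programme (`--supports stmt-CriticalPhenomena-4575`, prover prim-sahi-p2 gen 18).  No definitions, no named
facts, no sorries; standard axioms; pure real arithmetic.  Memo `run/shared/lean/prim/prim-sahi/FROM-prim-sahi-p2-gen18-*.md` §1,
`prim-sahi-p2/PROOF-E3.md` §28m.

THEOREM B (paper-level, §28m).  Let `G` be any finite weighted graph with root `s` and targets `a, b, c`, and let `e = {u,v}` be a pair of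
`H = G − s` whose removal splits the vertices of `H` into `L ∋ a, u` and `R ∋ b, c, v` with no other positive pair between `L` and `R` (a BRIDGE
of the environment separating ONE target from the other two).  Then `t ↦ E₃({s↔a},{s↔b},{s↔c})` under `w[e ↦ t]` is CONCAVE on `[0,1]`.  The
two sides are independent given the root; with the `L`-events `F = {a ~ u in L}`, `T = {a hit in L}`, `S = {u hit in L}` (`T = S` on `F`;
`α = P(F∖T)`, `γ = P(F∩T)`, `σ = P(S)`, `τ = P(T)`, `γ + K = P(T∩S)`) and the `R`-events `P′ = {v hit in R}` (`σ′`), `R_t = {t ~ v in R}`,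
`d_t = P(R_t ∖ P′)`, `d_bc = P(R_b ∩ R_c ∖ P′)`, `ξ_b, ξ_c ≥ 0`, `y_t = P(P′ ∩ {t hit})`, `m_t = P(t hit)`, the six slopes of the moments along
`e` are explicit and `E₃″(t) = −2V(t)` with `V` decreasing and `V(1) = σ·W`,
  `W = ασ′(ξ_b+ξ_c+d_bc) − ασ′(m_b d_c + m_c d_b) + 2(γ+K)d_b d_c − τσ d_b d_c − 3ασ′σ d_b d_c + α(d_b y_c + d_c y_b)`.
The probabilistic inputs are four classical inequalities: (H1) Harris in `R`: `σ′m_b ≤ y_b`, `σ′m_c ≤ y_c`; (H2) Harris in `L`: `τσ ≤ γ + K`;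
(H3) van den Berg–Kahn Thm 1.1 in `R` (ghost vertex for the open root-neighbours): `d_b d_c ≤ d_bc·P(¬P′) ≤ d_bc`; (H4) Harris in `L`:
`σ·(α+γ) ≤ γ`.  THIS FILE proves the purely algebraic conclusion `0 ≤ W` from (H1)–(H4) and the sign conditions — the part of the argument most
prone to slips, now kernel-checked (`IncStar.bridgeConcavity_core`).  The probabilistic identification of the slopes (verified exactly against two
independent engines on 240 random two-blob instances, `prim-sahi-p2/gen18/py/thmB_verify.py`) is NOT formalised here.  Consequence of Theorem B
(§28m, Theorem C): the increasing star holds on every graph whose environment `G − s` is a forest (all fans), by the chord induction with the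
blob reduction of `…SahiBlobReduction`.

* `bridgeConcavity_bracket` — `0 ≤ ασ′(1 − 3σ) + γ` from `σ(α+γ) ≤ γ`, `σ′ ≤ 1`;
* **`bridgeConcavity_core`** — `0 ≤ W` from (H1)–(H4).
-/

namespace Summit.CriticalPhenomena.PercolationContinuityZ3.Theorems

namespace IncStar

/-- The final bracket of the bridge-concavity estimate: if `σ·(α+γ) ≤ γ` (Harris: `P(u hit) ≤ P(a hit | a ~ u)`), `0 ≤ σ′ ≤ 1` and
`α, γ, σ ≥ 0`, then `0 ≤ α·σ′·(1 − 3σ) + γ`.  (For `σ ≤ 1/3` trivially; otherwise `ασ′(1−3σ) ≥ α(1−3σ)` and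
`(α+γ)(α+γ−3ασ) ≥ (α+γ)² − 3αγ = α² − αγ + γ² ≥ 0`; `σ ≥ 0` is not even needed.) [this work] -/
theorem bridgeConcavity_bracket (α γ σ σ' : ℝ) (hα : 0 ≤ α) (hγ : 0 ≤ γ) (hσ'0 : 0 ≤ σ') (hσ'1 : σ' ≤ 1)
    (H4 : σ * (α + γ) ≤ γ) : 0 ≤ α * σ' * (1 - 3 * σ) + γ := by
  by_cases h3 : 3 * σ ≤ 1
  · have h13 : 0 ≤ 1 - 3 * σ := by linarith
    have : 0 ≤ α * σ' * (1 - 3 * σ) := mul_nonneg (mul_nonneg hα hσ'0) h13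
    linarith
  · push Not at h3
    have h13 : 1 - 3 * σ ≤ 0 := by linarith
    -- `α σ' (1-3σ) ≥ α (1-3σ)` because the bracket is nonpositive and `σ' ≤ 1`
    have hstep : α * (1 - 3 * σ) ≤ α * σ' * (1 - 3 * σ) := by
      have h1 : α * σ' * (1 - 3 * σ) - α * (1 - 3 * σ) = α * (1 - σ') * (3 * σ - 1) := by ring
      have h2 : 0 ≤ α * (1 - σ') * (3 * σ - 1) :=
        mul_nonneg (mul_nonneg hα (by linarith)) (by linarith)
      linarith
    -- `α (1-3σ) + γ ≥ 0` from `σ(α+γ) ≤ γ`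
    have hkey : 0 ≤ α * (1 - 3 * σ) + γ := by
      by_cases hΩ : α + γ = 0
      · have hα0 : α = 0 := by linarith
        have hγ0 : γ = 0 := by linarith
        rw [hα0, hγ0]; simp
      · have hΩpos : 0 < α + γ := lt_of_le_of_ne (by linarith) (Ne.symm hΩ)
        -- (α+γ)·(α(1-3σ)+γ) = (α+γ)² - 3ασ(α+γ) ≥ (α+γ)² - 3αγ = α² - αγ + γ² ≥ 0
        have hprod : 0 ≤ (α + γ) * (α * (1 - 3 * σ) + γ) := by
          have h1 : (α + γ) * (α * (1 - 3 * σ) + γ) = (α + γ) ^ 2 - 3 * α * (σ * (α + γ)) := by ring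
          have h2 : 3 * α * (σ * (α + γ)) ≤ 3 * α * γ := by
            have := mul_le_mul_of_nonneg_left H4 (by linarith : (0 : ℝ) ≤ 3 * α)
            linarith
          have h3' : 0 ≤ α ^ 2 - α * γ + γ ^ 2 := by nlinarith [sq_nonneg (α - γ), mul_nonneg hα hγ]
          nlinarith [h1, h2, h3']
        by_contra hneg
        push Not at hneg
        have : (α + γ) * (α * (1 - 3 * σ) + γ) < 0 := mul_neg_of_pos_of_neg hΩpos hneg
        linarith
    linarith

/-- **Bridge concavity, algebraic core.**  With the notation of the module docstring: from the sign conditions, Harris in both sides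
(`H1b`, `H1c`, `H2`, `H4`) and van den Berg–Kahn 1.1 (`H3`), the bracket `W` — equal to `V(1)/σ`, i.e. `−E₃″(1)/(2σ)` along the bridge —
is nonnegative.  Hence `E₃` of the increasing star is concave in the weight of any environment bridge that separates one target from the
other two (Theorem B of PROOF-E3 §28m; the probabilistic slope identities are paper-level). [this work] -/
theorem bridgeConcavity_core (α γ σ τ K σ' db dc dbc ξb ξc yb yc mb mc : ℝ)
    (hα : 0 ≤ α) (hγ : 0 ≤ γ) (hσ'0 : 0 ≤ σ') (hσ'1 : σ' ≤ 1) (hK : 0 ≤ K)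
    (hdb : 0 ≤ db) (hdc : 0 ≤ dc) (hξb : 0 ≤ ξb) (hξc : 0 ≤ ξc)
    (H1b : σ' * mb ≤ yb) (H1c : σ' * mc ≤ yc) (H2 : τ * σ ≤ γ + K) (H3 : db * dc ≤ dbc) (H4 : σ * (α + γ) ≤ γ) :
    0 ≤ α * σ' * (ξb + ξc + dbc) - α * σ' * (mb * dc + mc * db) + 2 * (γ + K) * db * dc
        - τ * σ * db * dc - 3 * α * σ' * σ * db * dc + α * (db * yc + dc * yb) := by
  -- (H1): the Harris terms on the two-target side pay for the `m`-terms
  have h1 : α * σ' * (mb * dc + mc * db) ≤ α * (db * yc + dc * yb) := by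
    have hb : α * dc * (σ' * mb) ≤ α * dc * yb := mul_le_mul_of_nonneg_left H1b (mul_nonneg hα hdc)
    have hc : α * db * (σ' * mc) ≤ α * db * yc := mul_le_mul_of_nonneg_left H1c (mul_nonneg hα hdb)
    nlinarith [hb, hc]
  -- (H2): `2(γ+K) − τσ ≥ γ + K ≥ γ`
  have h2 : γ * (db * dc) ≤ 2 * (γ + K) * db * dc - τ * σ * db * dc := by
    have hdd : 0 ≤ db * dc := mul_nonneg hdb hdc
    have : 0 ≤ (γ + K - τ * σ) * (db * dc) := mul_nonneg (by linarith) hdd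
    have : 0 ≤ K * (db * dc) := mul_nonneg hK hdd
    nlinarith
  -- (H3): vdBK on the two-target side
  have h3 : α * σ' * (db * dc) ≤ α * σ' * dbc := mul_le_mul_of_nonneg_left H3 (mul_nonneg hα hσ'0)
  -- nonnegative leftovers
  have hξ : 0 ≤ α * σ' * (ξb + ξc) := mul_nonneg (mul_nonneg hα hσ'0) (by linarith)
  -- the bracket
  have hbr : 0 ≤ α * σ' * (1 - 3 * σ) + γ := bridgeConcavity_bracket α γ σ σ' hα hγ hσ'0 hσ'1 H4
  have hmain : 0 ≤ (db * dc) * (α * σ' * (1 - 3 * σ) + γ) := mul_nonneg (mul_nonneg hdb hdc) hbr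
  -- assemble: W ≥ ασ'(db dc) + γ(db dc) − 3ασ'σ(db dc) + [nonneg] = (db dc)(ασ'(1−3σ)+γ) + [nonneg]
  have hid : (db * dc) * (α * σ' * (1 - 3 * σ) + γ)
      = α * σ' * (db * dc) + γ * (db * dc) - 3 * α * σ' * σ * db * dc := by ring
  nlinarith [h1, h2, h3, hξ, hmain, hid]

/-- **Bridge concavity of the cubic, from the product-form slopes (Theorem B modulo the event identities).**  Along a bridge `e` of the
environment separating target `a` (side `L`) from `b, c` (side `R`) the moments of the three events are affine in `t = w_e` with
`t = 0` values `τ, m_b, m_c, τ m_b, τ m_c, m_bc, τ m_bc` (independent sides) and slopes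
`δ_a = ασ′`, `δ_b = d_b σ`, `δ_c = d_c σ`, `δ_ab = (γ+K)d_b + α y_b`, `δ_ac = (γ+K)d_c + α y_c`, `δ_bc = σ(ξ_b+ξ_c+d_bc)` (`δ_abc` arbitrary).
Then, granted the four classical inequalities (H1)–(H4) of `bridgeConcavity_core` and the sign conditions, Sahi's cubic lies ABOVE ITS CHORDS on
`[0,1]`: `(1−t)E₃(0) + tE₃(1) ≤ E₃(t)`.  Key identity (checked by `ring`): `E₃(t) − [(1−t)E₃(0) + tE₃(1)] = t(1−t)·(σ·W + δ_aδ_bδ_c(2−t))` with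
`W` the bracket of `bridgeConcavity_core`.  PROOF-E3 §28m, steps (3)–(7). [this work] -/
theorem bridgeConcavity_chord (τ mb mc mbc δabc α γ σ K σ' db dc dbc ξb ξc yb yc t : ℝ)
    (hα : 0 ≤ α) (hγ : 0 ≤ γ) (hσ : 0 ≤ σ) (hσ'0 : 0 ≤ σ') (hσ'1 : σ' ≤ 1) (hK : 0 ≤ K)
    (hdb : 0 ≤ db) (hdc : 0 ≤ dc) (hξb : 0 ≤ ξb) (hξc : 0 ≤ ξc)
    (H1b : σ' * mb ≤ yb) (H1c : σ' * mc ≤ yc) (H2 : τ * σ ≤ γ + K) (H3 : db * dc ≤ dbc) (H4 : σ * (α + γ) ≤ γ)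
    (ht0 : 0 ≤ t) (ht1 : t ≤ 1) :
    let δa := α * σ'
    let δb := db * σ
    let δc := dc * σ
    let δab := (γ + K) * db + α * yb
    let δac := (γ + K) * dc + α * yc
    let δbc := σ * (ξb + ξc + dbc)
    let E3 : ℝ → ℝ := fun x =>
      2 * (τ * mbc + x * δabc) + (τ + x * δa) * (mb + x * δb) * (mc + x * δc)
        - (τ + x * δa) * (mbc + x * δbc) - (mb + x * δb) * (τ * mc + x * δac) - (mc + x * δc) * (τ * mb + x * δab)
    (1 - t) * E3 0 + t * E3 1 ≤ E3 t := by
  intro δa δb δc δab δac δbc E3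
  have hW := bridgeConcavity_core α γ σ τ K σ' db dc dbc ξb ξc yb yc mb mc hα hγ hσ'0 hσ'1 hK hdb hdc hξb hξc H1b H1c H2 H3 H4
  have key : E3 t - ((1 - t) * E3 0 + t * E3 1)
      = t * (1 - t) * (σ * (α * σ' * (ξb + ξc + dbc) - α * σ' * (mb * dc + mc * db) + 2 * (γ + K) * db * dc
        - τ * σ * db * dc - 3 * α * σ' * σ * db * dc + α * (db * yc + dc * yb)) + δa * δb * δc * (2 - t)) := by
    simp only [E3, δa, δb, δc, δab, δac, δbc]
    ring
  have hddd : 0 ≤ δa * δb * δc * (2 - t) := by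
    have : 0 ≤ δa * δb * δc := mul_nonneg (mul_nonneg (mul_nonneg hα hσ'0) (mul_nonneg hdb hσ)) (mul_nonneg hdc hσ)
    exact mul_nonneg this (by linarith)
  have hin : 0 ≤ σ * (α * σ' * (ξb + ξc + dbc) - α * σ' * (mb * dc + mc * db) + 2 * (γ + K) * db * dc
        - τ * σ * db * dc - 3 * α * σ' * σ * db * dc + α * (db * yc + dc * yb)) + δa * δb * δc * (2 - t) :=
    add_nonneg (mul_nonneg hσ hW) hddd
  have ht : 0 ≤ t * (1 - t) := mul_nonneg ht0 (by linarith)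
  nlinarith [mul_nonneg ht hin, key]

end IncStar

end Summit.CriticalPhenomena.PercolationContinuityZ3.Theorems
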